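import Summits.ResolutionOfSingularities.ResolutionOfSingularities.Theorems.MarkedTransferCampaignW24ReducedBridgePIffCarrier
import HarnessLib

/-!
# The LEVEL-`q` bridge at an ARBITRARY PRIME `p`, part 9: the `n = 1` slice of ⟨`Rescue.FiniteSupportStaysInBox_ours p`⟩ IS the reduced
# residual «every finitely supported reduced run is exhausted in box at infinitely many p-power depths», BY NAME (HIRONAKA-L · cell
# `res-hironaka` · slot W2.4 «bottom-member re-run»; one `↔` packaging `…PSlice` (←) and `…PIff` (→))

**HONEST FRAMING.** OURS throughout: kernel theorems connecting OURS objects of the cell (res-L1-k24's `CampaignW24.ReducedRun`, the OURS premise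
`Rescue.CarrierStaysInBox`, res-D-pv-020's `CampaignW24.ReducedBridge(P)`). Nothing below is a statement of H. Hironaka's manuscript [Hironaka2017]
(lit key `paper:url-3343fd9e678b`), nothing asserts that any statement of it holds, nothing is a claim about resolution of singularities in
characteristic `p`; the manuscript stays «under review» (D-0012/D-0089). AI work, weaker than expert review. Written by res-D-pv-020 (W2.4 lineage).

## What is proved (`p` prime; both sides quantify over all fields `K` of characteristic `p` with `[ExpChar K p] [PerfectRing K p]`)
* `coe_twinPoly`: the twin carrier `x·G(x^p)` of a finitely supported `G` is (the image of) a polynomial.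
* **`carrierStaysInBox_fin_one_iff_reduced_exhaustion (p)`**:
  `(∀ K e (P : MvPolynomial (Fin 1) K), Rescue.CarrierStaysInBox p e ↑P) ↔
   (∀ K (G : K⟦t⟧), G finitely supported → 2 ≤ ord G → ∀ a₀ ∃ a ≥ a₀ ∃ i₁, (∀ i < i₁, canonRun p^a G i ≠ 0 ∧ 2 ≤ ord < p^a) ∧ canonRun p^a G i₁ = 0)`.
  The left side is LITERALLY the `n = 1` slice of `Rescue.FiniteSupportStaysInBox_ours p`; the right side mentions only res-L1-k24's reduced run.
  At `p = 2` the right side is res-L1-type-o6's theorem (`…PSlice.reduced_exhaustion_eventually_two`); at odd `p` it is OPEN (res-type-059's census: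
  no boundary-free immortal cycle found). Hypotheses: each theorem's own binders; no FACT-LIST fact, no DEFECT binder. Standard axioms only.
-/

noncomputable section

set_option linter.dupNamespace false -- mandated namespace of this single-conjunct summit

namespace Summit.ResolutionOfSingularities.ResolutionOfSingularities.Theorems

namespace CampaignW24

namespace ReducedBridgeP

open Literature.AlgebraicGeometry.Hironaka2017.S08UnitMonomial (StandardExpression)
open Literature.AlgebraicGeometry.Hironaka2017.S09LLUED
open CampaignW21 (xs hasseD)
open ReducedBridge

variable {K : Type} [Field K] {p : ℕ} [hp : Fact p.Prime]

/-- **The twin carrier of a finitely supported `G` is a polynomial**: `↑(Σ_{m ≤ B} g_m·x^{1+p·m}) = Φ_{p,1} G` when `G` is supported below `B`.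
[folklore] -/
theorem coe_twinPoly {G : PowerSeries K} {B : ℕ} (hB : ∀ m, B < m → PowerSeries.coeff m G = 0) :
    ((∑ m ∈ Finset.range (B + 1), MvPolynomial.monomial (Finsupp.single (0 : Fin 1) (1 + p * m)) (PowerSeries.coeff m G) :
        MvPolynomial (Fin 1) K) : MvPowerSeries (Fin 1) K) = phiQ (p ^ 1) (ppow_ne_zero p 1) 1 G := by
  have hp1 : 1 < p := hp.out.one_lt
  ext d
  rw [MvPolynomial.coeff_coe, MvPolynomial.coeff_sum, coeff_phiQ_of_lt _ (by rw [pow_one]; exact hp1)]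
  simp only [MvPolynomial.coeff_monomial, pow_one]
  have hkey : ∀ m, Finsupp.single (0 : Fin 1) (1 + p * m) = d ↔ d 0 % p = 1 ∧ d 0 / p = m := by
    intro m
    constructor
    · rintro rfl
      rw [Finsupp.single_eq_same]
      exact ⟨by rw [Nat.add_mul_mod_self_left, Nat.mod_eq_of_lt hp1],
        by rw [Nat.add_mul_div_left _ _ hp.out.pos, Nat.div_eq_of_lt hp1, zero_add]⟩
    · rintro ⟨h1, h2⟩
      rw [eq_single d]
      congr 1
      rw [← h2]
      have h3 := Nat.mod_add_div (d 0) p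
      rw [h1] at h3
      exact h3
  split_ifs with h
  · rw [Finset.sum_eq_single (d 0 / p)]
    · rw [if_pos ((hkey _).mpr ⟨h, rfl⟩)]
    · intro b _ hb
      rw [if_neg]
      intro hbd
      exact hb ((hkey b).mp hbd).2.symm
    · intro hnot
      have hBlt : B < d 0 / p := by
        rw [Finset.mem_range] at hnot; omega
      simp [hB _ hBlt]
  · refine Finset.sum_eq_zero fun m _ => ?_
    rw [if_neg]
    intro hmd
    exact h ((hkey m).mp hmd).1

/-- **THE `n = 1` SLICE OF THE OURS PREMISE IS THE REDUCED RESIDUAL, BY NAME.** For a prime `p`: ⟨`Rescue.FiniteSupportStaysInBox_ours p`⟩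
restricted to one variable (every field `K` of characteristic `p` with the premise binders, every level `e`, every polynomial `P`) holds IF AND
ONLY IF every finitely supported `G ∈ K⟦t⟧` with `2 ≤ ord G` (every such `K`) has res-L1-k24's canonical reduced run EXHAUSTED IN BOX at infinitely
many `p`-power depths. (←) `…PSlice`; (→) the twin carrier `x·G(x^p)` is a polynomial (`coe_twinPoly`) and `…PIff`'s `carrierStaysInBox_phiQ_iff`
at `e = 1`, `r₀ = 1`. OURS objects; nothing about the manuscript. [folklore] -/
theorem carrierStaysInBox_fin_one_iff_reduced_exhaustion (p : ℕ) [hp : Fact p.Prime] :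
    (∀ (K : Type) [Field K] [CharP K p] [ExpChar K p] [PerfectRing K p] (e : ℕ) (P : MvPolynomial (Fin 1) K),
        Rescue.CarrierStaysInBox p e (P : MvPowerSeries (Fin 1) K)) ↔
      ∀ (K : Type) [Field K] [CharP K p] [ExpChar K p] [PerfectRing K p] (G : PowerSeries K),
        (∃ B : ℕ, ∀ m, B < m → PowerSeries.coeff m G = 0) → (2 : ℕ∞) ≤ PowerSeries.order G →
          ∀ a₀ : ℕ, ∃ a : ℕ, a₀ ≤ a ∧ ∃ i₁ : ℕ,
            (∀ i < i₁, ReducedRun.canonRun (p ^ a) G i ≠ 0 ∧ (2 : ℕ∞) ≤ PowerSeries.order (ReducedRun.canonRun (p ^ a) G i) ∧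
              PowerSeries.order (ReducedRun.canonRun (p ^ a) G i) < ((p ^ a : ℕ) : ℕ∞)) ∧
            ReducedRun.canonRun (p ^ a) G i₁ = 0 := by
  constructor
  · intro hbind K _ _ _ _ G hfin h2 a₀
    by_cases hG : G = 0
    · exact ⟨a₀, le_rfl, 0, fun i hi => absurd hi (Nat.not_lt_zero i), by rw [hG]; rfl⟩
    obtain ⟨B, hB⟩ := hfin
    have h := hbind K 1 (∑ m ∈ Finset.range (B + 1),
      MvPolynomial.monomial (Finsupp.single (0 : Fin 1) (1 + p * m)) (PowerSeries.coeff m G))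
    rw [coe_twinPoly hB] at h
    have hr₀ : 1 < p ^ 1 := by rw [pow_one]; exact hp.out.one_lt
    have hr₀p : 1 % p ≠ 0 := by rw [Nat.mod_eq_of_lt hp.out.one_lt]; exact one_ne_zero
    exact (carrierStaysInBox_phiQ_iff Nat.one_pos hr₀ hr₀p hG h2).mp h a₀
  · intro hred K _ _ _ _ e P
    exact carrierStaysInBox_coe_fin_one_of_reduced_exhaustion p (hred K) e P

/-- **At `p = 2`: every one-variable carrier whose TOP RESIDUE CLASS is finitely supported satisfies the OURS premise — the passenger may be ANY
series** (`F = Φ_{q,r₀} G + R`, `0 < e`, `r₀ < q = 2^e`, `G ≠ 0` finitely supported with `G(0) = 0`, passenger residues lex-below `r₀` and visible in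
`F`): `Rescue.CarrierStaysInBox 2 e F`. (res-L1-type-o6's death theorem on `G`, resp. on `univStepIIIq (q/r₀+1) G` at bottom digit `1`, fed into
`…PSlice`'s confinement; no order hypothesis is needed since the premise carries its own.) Extends p536859 beyond polynomial carriers. [folklore] -/
theorem carrierStaysInBox_two_of_finite_top_class {L : Type} [Field L] [CharP L 2] [ExpChar L 2] [PerfectRing L 2] {e : ℕ} (he : 0 < e)
    {r₀ : ℕ} (hr₀ : r₀ < 2 ^ e) {good : ℕ → Prop} (hgood : ∀ ρ, good ρ → PairLTP 2 ρ r₀) {F R : MvPowerSeries (Fin 1) L}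
    {G : PowerSeries L} (hF : F = phiQ (2 ^ e) (ppow_ne_zero 2 e) r₀ G + R) (hR : ResIn (2 ^ e) good R)
    (hvis : ∀ ρ, good ρ → ∃ d : Fin 1 →₀ ℕ, MvPowerSeries.coeff d F ≠ 0 ∧ d 0 % 2 ^ e = ρ) (hG : G ≠ 0)
    (hG0 : PowerSeries.constantCoeff G = 0) (hfin : ∃ B : ℕ, ∀ m, B < m → PowerSeries.coeff m G = 0) :
    Rescue.CarrierStaysInBox 2 e F := by
  intro ℓ₀ X₀ _ hle h0 hα _
  by_cases hc1 : PowerSeries.coeff 1 G = 0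
  · have h2 : (2 : ℕ∞) ≤ PowerSeries.order G := PowerSeries.nat_le_order _ _ fun i hi => by
      interval_cases i
      · rw [PowerSeries.coeff_zero_eq_constantCoeff]; exact hG0
      · exact hc1
    obtain ⟨a, ha, i₁, hpre, hzero⟩ := reduced_exhaustion_eventually_two G hfin h2 ℓ₀
    refine ⟨e + a, by omega, ?_⟩
    have hae : e + a - e = a := by omega
    refine staysInBox_of_level_of_reduced_exhaustionP he (by omega) hr₀ hgood hG X₀ hF hR hle hvis (i₁ := i₁) ?_ ?_
    · rw [hae]; exact hpre
    · rw [hae]; exact hzero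
  · have hk : PowerSeries.order G = (1 : ℕ) := PowerSeries.order_eq_nat.mpr ⟨hc1, fun i hi => by
      interval_cases i
      rw [PowerSeries.coeff_zero_eq_constantCoeff]; exact hG0⟩
    obtain ⟨hαe, -⟩ := alpha_beta_of_levelP X₀ hF hr₀ hR hgood he hle hG
    have hr₀pos : 0 < r₀ := by
      by_contra h0'
      apply hα
      rw [hαe, Nat.eq_zero_of_not_pos h0', Nat.zero_mod, Finsupp.single_zero]
    obtain ⟨B, hB⟩ := hfin
    set kb := 2 ^ e / r₀ + 1 with hkb
    obtain ⟨a, ha, i₁, hpre, hzero⟩ := reduced_exhaustion_eventually_two (ReducedRun.univStepIIIq kb G)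
      ⟨(2 ^ kb + 1) * B, ReducedRun.coeff_univStepIIIq_eq_zero_of_bound hB⟩ (ReducedRun.two_le_order_univStepIIIq kb hG0) (max ℓ₀ (B + 1))
    refine ⟨e + a, by omega, ?_⟩
    have hae : e + a - e = a := by omega
    have hBP : B < 2 ^ a := lt_of_lt_of_le Nat.lt_two_pow_self (Nat.pow_le_pow_right two_pos (show B ≤ a by omega))
    have hcanon : ReducedRun.canonStepIIIq (2 ^ (e + a - e)) kb G = ReducedRun.univStepIIIq kb G := by
      rw [hae]; exact ReducedRun.canonStepIIIq_eq_univStepIIIq fun m hm => hB m (by omega)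
    refine staysInBox_of_level_of_reduced_exhaustion_digitOneP he (by omega) hr₀ hr₀pos hgood hk X₀ hF hR hle hvis (i₁ := i₁) ?_ ?_
    · intro i hi
      rw [hcanon, hae]
      exact hpre i hi
    · rw [hcanon, hae]; exact hzero

end ReducedBridgeP

end CampaignW24

end Summit.ResolutionOfSingularities.ResolutionOfSingularities.Theorems

end
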